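import Mathlib
import HarnessLib
import Summits.ValiantsHypothesis.ValiantsHypothesis.Theorems.ValuativeGCTTailFlipStubIsobaricInheritance
import Summits.ValiantsHypothesis.ValiantsHypothesis.Theorems.ValuativeGCTTailFlipStubIsobaricSizeLift
import Literature.Computability.Complexity.OccurrenceObstructionsIPProofs

/-!
# `ValuativeGCT.TailFlip` (stmt-ValiantsHypothesis-15687), line `Sketch` (isobaric anchors): anchored inheritance

The per-side half of the line's skeleton (`Cruxes/TailFlip/Lines/Sketch.lean`, glue
`anchored_le_orbitMultiplicity`), sorry-free over the two landed stubs
`Theorems.TailFlip.stub_isobaricSizeLift` (inner-size monotonicity `K ↦ K + i`) and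
`Theorems.TailFlip.stub_isobaricInheritance` (the engine at every padding `j`):

* `anchored_le_orbitMultiplicity` — ONE untwisted evaluation certificate of size `D` on `x_t`-isobaric
  points `A_l · per_K` of a small anchor permanent `per_K` (inner highest-weight vectors of weight `μ*`,
  `μ ⊢ Kδ`, `≤ K²` parts) gives `D ≤ mult_{((μ♯(K+i))♯(K+i+j))*} ℂ[Δ_{K+i+j}(X₀₀^j per_{K+i})]` for EVERY
  inner size `K + i` and EVERY padding `j` ("one inner certificate, the whole tail");
* `card_parts_rowLift_rowLift_le` — the doubly row-lifted shape has `≤ (K+i+j)²` parts.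

What is NOT here: any certificate (the open census stub `stub_isobaricTailCensus` of the line supplies
them); constraints on where anchors can live are in `Theorems/ValuativeGCTTailFlipCertificateDomination`.

Sources: this crux, `Cruxes/TailFlip/Ideas/isobaric-anchors.md` §(1),(4); Ikenmeyer–Panova 2017
(arXiv:1512.03798) Prop. 2.6(b); Bürgisser–Ikenmeyer–Panova 2019 Lemma 5.2, Thm 5.4; BLMW 2011 §6.4.
-/

set_option linter.dupNamespace false

namespace Summit.ValiantsHypothesis.ValiantsHypothesis.Theorems.TailFlip

open MvPolynomial
open scoped BigOperators Matrix
open Literature.NumberTheory.DiophantineGeometry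
open Literature.Computability.AlgebraicComplexity
open Literature.Computability.Complexity

noncomputable section

/-- A doubly row-lifted shape `(μ♯(K+i))♯(K+i+j)` of a shape `μ ⊢ Kδ` with `≤ K²` parts (`K ≥ 1`) has
`≤ (K+i+j)²` parts. [folklore] -/
theorem card_parts_rowLift_rowLift_le {K δ : ℕ} [NeZero K] (μ : Nat.Partition (K * δ))
    (hμ : μ.parts.card ≤ K * K) (i j : ℕ) :
    (rowLift (rowLift μ i) j).parts.card ≤ (K + i + j) * (K + i + j) := by
  have hKK : 1 ≤ K * K := Nat.one_le_iff_ne_zero.2 (mul_ne_zero (NeZero.ne K) (NeZero.ne K))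
  have h1 : (rowLift μ i).parts.card ≤ K * K := (card_parts_rowLift_le μ i).trans (max_le hμ hKK)
  have h2 : (rowLift (rowLift μ i) j).parts.card ≤ K * K :=
    (card_parts_rowLift_le _ j).trans (max_le h1 hKK)
  exact h2.trans (Nat.mul_le_mul (by omega) (by omega))

/-- **Anchored inheritance** ("one inner certificate, the whole tail").  Let `K ≥ 1` be the anchor
size, `μ ⊢ Kδ` a shape with `≤ K²` parts, `F₁ … F_D` highest-weight vectors of weight `μ*` on
`ℂ[Sym^K ℂ^{K²}]`, and `A_l · per_K` (`l < D`) inner `End`-points of the permanent that are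
`x_t`-ISOBARIC (every monomial of `A_l · per_K` has exponent `e₀ l` at the top variable
`x_t = X (topMatIdx K)`) with NONSINGULAR UNTWISTED evaluation matrix `(F_i(A_l · per_K))_{i,l}`.  Then
for every inner size `K + i` and every padding `j`,
`D ≤ mult_{((μ♯(K+i))♯(K+i+j))*} ℂ[Δ_{K+i+j}(X₀₀^j per_{K+i})]`
(`orbitMultiplicity` of the route's `paddedPerFormLex ℂ (K+i) (K+i+j)` at the doubly row-lifted shape).
Proof: transport the certificate to inner size `K + i` (`stub_isobaricSizeLift`: block
`per_K ⊕ x_t · I_i`, still isobaric, still untwisted) and run the engine (`stub_isobaricInheritance`: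
the Kadish–Landsberg twist is a scalar on isobaric points) at padding `j`.
[this crux, Cruxes/TailFlip/Ideas/isobaric-anchors.md §(1),(4); arXiv:1512.03798 Prop. 2.6(b)] -/
theorem anchored_le_orbitMultiplicity :
    ∀ (K i j δ : ℕ) [NeZero K] [NeZero (K + i)] [NeZero (K + i + j)] (μ : Nat.Partition (K * δ)),
      μ.parts.card ≤ K * K →
      ∀ (D : ℕ) (F : Fin D → MvPolynomial (DegIdx (MatIdx K) K) ℂ),
        (∀ i', F i' ∈ highestWeightSpace (coordRep (MatIdx K) ℂ K) (partitionWeightLex K μ)) →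
        ∀ (A : Fin D → Matrix (MatIdx K) (MatIdx K) ℂ) (e₀ : Fin D → ℕ),
          (∀ l, ∀ e ∈ (linSubst (MatIdx K) ℂ (A l) (paddedPerFormLex ℂ K K)).support, e (topMatIdx K) = e₀ l) →
          (Matrix.of fun i' l : Fin D => MvPolynomial.aeval
              (fun e : DegIdx (MatIdx K) K =>
                MvPolynomial.coeff e.1 (linSubst (MatIdx K) ℂ (A l) (paddedPerFormLex ℂ K K))) (F i')).det ≠ 0 →
          D ≤ orbitMultiplicity ℂ (paddedPerFormLex ℂ (K + i) (K + i + j)) (K + i + j)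
            (partitionWeightLex (K + i + j) (rowLift (rowLift μ i) j)) := by
  intro K i j δ _ _ _ μ hμ D F hF A e₀ hiso hdet
  obtain ⟨F', A', hF', hiso', hdet'⟩ := stub_isobaricSizeLift K i δ μ hμ D F hF A e₀ hiso hdet
  have hμ' : (rowLift μ i).parts.card ≤ (K + i) * (K + i) :=
    (card_parts_rowLift_le μ i).trans
      (max_le (hμ.trans (Nat.mul_le_mul (Nat.le_add_right K i) (Nat.le_add_right K i)))
        (Nat.one_le_iff_ne_zero.2 (mul_ne_zero (NeZero.ne (K + i)) (NeZero.ne (K + i)))))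
  exact stub_isobaricInheritance (K + i) j δ (rowLift μ i) hμ' D F' hF' A' (fun l => e₀ l + i) hiso' hdet'

end

end Summit.ValiantsHypothesis.ValiantsHypothesis.Theorems.TailFlip
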